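import Summits.BirchSwinnertonDyer.BirchSwinnertonDyer.Theses.LeadingTerm
import Summits.BirchSwinnertonDyer.BirchSwinnertonDyer.Theses.Squeeze
import HarnessLib

/-!
# Line `selmer_cap_junction` for crux `LeadingTerm.SqueezeUBR2`
# (stmt-BirchSwinnertonDyer-0145 `squeeze_UB`; byte-identical `Squeeze.SqueezeUB` stmt-0496,
# `HigherGrossZagier.SqueezeUB`; route `route-BirchSwinnertonDyer-LeadingTerm`, rev 14)

Registered by the crux strategist `cstrat-stmt-BirchSwinnertonDyer-0145-p2-g3` (wall-breaker gen 3,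
2026-08-29). Card: `Lines/selmer_cap_junction.md`. Census: `STRATEGY-CENSUS.md` (v9).

## What this line is — said plainly

It is the DECOMPOSITION OF RECORD of the crux (split D9, route rev 14: `SqueezeUBR2 ⟸
SelmerCapAtOnePrime ∧ GZKRankLeOne`, glue landed as
`Theorems.squeezeUB_of_selmerCapAtOnePrime_of_rankLeOne_statement` = route decl
`SqueezeUBR2GlueBy_holds`, p677769 / p678009) PROMOTED TO THE CRUX'S STANDING SKELETON LINE, so that
the crux has a registered, checked, non-dead line whose stubs are exactly the two child ITEMS:

* `stub_selmerCapAtOnePrime` — VERBATIM the signature of item stmt-BirchSwinnertonDyer-19215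
  (`LeadingTerm.SelmerCapAtOnePrime`, crux rank 401; shared with route PadicCornerSqueeze, which holds
  its mechanism skeleton `Cruxes/SelmerCapAtOnePrime/Lines/birth.lean`: Kurihara-number certificate at
  one admissible ordinary prime for non-CM curves via C.-H. Kim, arXiv:2203.12159 Thm 1.9(1), + Rubin /
  Kato Thm 18.4 squeeze for CM curves). This is the load-bearing, research-sized stub: forward rank-`r`
  BSD in SELMER FORM at ONE prime on the locus `r_an ≥ 2` (first open cell: `r_an = 2`).
* `stub_gzkRankLeOne` — VERBATIM the signature of item stmt-BirchSwinnertonDyer-17525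
  (`LeadingTerm.GZKRankLeOne`, support rank 402): `r_an ≤ 1 ⇒ r_an = rank` (Gross–Zagier 1986 +
  Kolyvagin 1990 + BFH/MM non-vanishing twist; Kato 2004 for `r_an = 0`) — a THEOREM in print, open only
  as a formalisation debt (`bsd.S17`).

The composition `SqueezeUBR2_of` is the route's own landed glue. ZERO new mathematics is claimed: the
point of registering it is operational and epistemic — (i) the only other registered line on this crux
(`Lines/Sketch.lean`, cells GZK/PAR/UBE4) is DEAD at UBE4 because UBE4 is the crux on its open locus with
no mechanism; this line cuts by MECHANISM (Selmer corank at one prime, the quantity Euler/Kolyvagin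
systems and Kurihara numbers actually bound) rather than by rank cell, and its open stub HAS a registered
mechanism skeleton one level down; (ii) a lead seated here finds both stubs are live ledger items and
parks the line `blocked-on: stmt-19215, stmt-17525` — staffing flows to the child, once, instead of a
seventh strategist seat on an unchanged cone. Six strategist censuses (v3–v8) and this seat's independent
re-derivation (census v9 §1) agree that no transfer / strengthening / negation gives leverage on the
crux short of this Selmer-form child; see the card for the one-paragraph why.

## Disproof used

`Cruxes/SqueezeUB/Disproof.lean` §2 / landed `Theorems/SqueezeUB/Negative/FalseWithoutIsElliptic.lean`
(`squeezeUB_false_without_isElliptic`, p131586): the crux is FALSE without `[W.IsElliptic]` (the cusp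
`⟨0,0,0,0,0⟩` has `mordellWeilRank = 1`, `analyticRank = 0`). Honoured: BOTH stubs carry the
`[W.IsElliptic]` binder (stub 1 additionally `[W.IsGloballyMinimal]`, discharged in the glue by
`hasGlobalMinimalModel_rat_holds` + `mordellWeilRank_variableChange_holds` + `analyticRank_smul`), so the
cusp witness instantiates neither stub (`example` at the end of the file: the cusp is not elliptic). No refuted strengthening of Disproof.lean is a
stub here: the `∀p` Selmer cap (refutable by a single prime of positive Ш-corank? — no: open, but
needlessly strong) is NOT used; the `∃p` form is.
-/

namespace Summit.BirchSwinnertonDyer.BirchSwinnertonDyer.Cruxes.SqueezeUB.SelmerCapJunction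

open Summit.BirchSwinnertonDyer.BirchSwinnertonDyer.Theses.LeadingTerm

/-- **S1 · `stub_selmerCapAtOnePrime`** (= item stmt-BirchSwinnertonDyer-19215 VERBATIM; load-bearing,
research-sized, OPEN): for every elliptic curve `E/ℚ` on a global minimal model `W` with
`ord_{s=1} L(E,s) ≥ 2` there is ONE prime `p` with `corank_{ℤ_p} Sel_{p^∞}(E/ℚ) ≤ ord_{s=1} L(E,s)`.
Why plausibly true: it is implied by (rank part of BSD) ∧ (Ш(E)[p^∞] finite at one prime), both
standard conjectures, and is verified curve-by-curve by descent (Cremona's tables; Kim 2022 §8: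
389a1, 5077a1 at p = 5). Why it might fail / why hard: it CONTAINS `rank ≤ r_an` on the non-trivial
locus; for `r_an ≥ 2` no mechanism in print bounds a Selmer corank by the ARCHIMEDEAN order of
vanishing (barrier `Literature.Barriers.BirchSwinnertonDyer.SelmerRankBarrier`; census v9 B3/B7: every
known Selmer-class non-vanishing criterion at rank 2 — Castella–Hsieh arXiv:1809.09066 Thm A / Cor C,
Darmon–Rotger — is keyed to the SELMER rank, not to `L''(E,1)`). Mechanism skeleton one level down:
`Cruxes/SelmerCapAtOnePrime/Lines/birth.lean` (stubs `stub_kim`, `stub_certificate_nonCM`, `stub_capCM`,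
`stub_orderCapCM_atOnePrime`). [size: XL / open problem] -/
theorem stub_selmerCapAtOnePrime :
    ∀ (W : WeierstrassCurve ℚ) [W.IsElliptic] [W.IsGloballyMinimal], 2 ≤ W.analyticRank →
      ∃ (p : ℕ) (_ : Fact p.Prime), W.selmerCorank p ≤ W.analyticRank := by
  sorry

/-- **S2 · `stub_gzkRankLeOne`** (= item stmt-BirchSwinnertonDyer-17525 VERBATIM; a THEOREM in print,
open as a formalisation debt `bsd.S17`): `ord_{s=1} L(E,s) ≤ 1 ⇒ ord_{s=1} L(E,s) = rank_ℤ E(ℚ)`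
(Gross–Zagier 1986 Thm I.6.3 + Kolyvagin 1990 + a non-vanishing quadratic twist,
Bump–Friedberg–Hoffstein 1990 / Murty–Murty 1991; `r_an = 0`: also Kato 2004 Thm 14.2).
[size: XL as a formalisation; mathematically settled] -/
theorem stub_gzkRankLeOne :
    ∀ (W : WeierstrassCurve ℚ) [W.IsElliptic], W.analyticRank ≤ 1 →
      W.analyticRank = W.mordellWeilRank := by
  sorry

/-! ## Stub statements by name (registrar convention: hypotheses of `<Crux>_of` are the stubs BY NAME) -/

namespace Statement

/-- Statement of `stub_selmerCapAtOnePrime` (= item stmt-BirchSwinnertonDyer-19215 `SelmerCapAtOnePrime`). -/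
abbrev stub_selmerCapAtOnePrime : Prop := type_of% @SelmerCapJunction.stub_selmerCapAtOnePrime
/-- Statement of `stub_gzkRankLeOne` (= item stmt-BirchSwinnertonDyer-17525 `GZKRankLeOne`). -/
abbrev stub_gzkRankLeOne : Prop := type_of% @SelmerCapJunction.stub_gzkRankLeOne

end Statement

/-! ## The composition (sorry-free) -/

/-- **`SqueezeUB_of` — the two stub STATEMENTS imply the crux BY NAME** (the registrar keys crux item
stmt-BirchSwinnertonDyer-0145 to its primary decl `Theses.Squeeze.SqueezeUB`, byte-identical with
`LeadingTerm.SqueezeUBR2` and `HigherGrossZagier.SqueezeUB`). The proof is the route's landed split glue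
`LeadingTerm.SqueezeUBR2GlueBy_holds` (= `Theorems.squeezeUB_of_selmerCapAtOnePrime_of_rankLeOne_statement`,
p678009; underlying `Theorems.squeezeUBR2_of_subs`, p677769): case `r_an ≤ 1` by S2; case `r_an ≥ 2` pass to
a global minimal model (AEC VIII.8.3 over ℚ), take the prime of S1, use the Kummer inequality
`rank ≤ corank Sel_{p^∞}` (`selmerCorank_eq_mordellWeilRank_add_holds`) and transport rank and analytic rank
back along the isomorphism; then definitional unfolding of the two identical `def`s. -/
theorem SqueezeUB_of (h1 : Statement.stub_selmerCapAtOnePrime) (h2 : Statement.stub_gzkRankLeOne) :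
    Summit.BirchSwinnertonDyer.BirchSwinnertonDyer.Theses.Squeeze.SqueezeUB := by
  show ∀ (W : WeierstrassCurve ℚ) [W.IsElliptic], W.mordellWeilRank ≤ W.analyticRank
  exact SqueezeUBR2GlueBy_holds (fun W _ _ h => h1 W h) (fun W _ h => h2 W h)

/-- The crux under its primary item name, MODULO the two registered stubs (the only sorries of this
file live inside `stub_*`). -/
theorem SqueezeUB_proof :
    Summit.BirchSwinnertonDyer.BirchSwinnertonDyer.Theses.Squeeze.SqueezeUB :=
  SqueezeUB_of stub_selmerCapAtOnePrime stub_gzkRankLeOne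

/-- The same composition under the route-LeadingTerm name of the crux (`SqueezeUBR2`, the decl this
route's `closes` consumes). -/
theorem SqueezeUBR2_of (h1 : Statement.stub_selmerCapAtOnePrime) (h2 : Statement.stub_gzkRankLeOne) :
    Summit.BirchSwinnertonDyer.BirchSwinnertonDyer.Theses.LeadingTerm.SqueezeUBR2 :=
  SqueezeUBR2GlueBy_holds (fun W _ _ h => h1 W h) (fun W _ h => h2 W h)

/-- `SqueezeUBR2` modulo the two stubs. -/
theorem SqueezeUBR2_proof :
    Summit.BirchSwinnertonDyer.BirchSwinnertonDyer.Theses.LeadingTerm.SqueezeUBR2 :=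
  SqueezeUBR2_of stub_selmerCapAtOnePrime stub_gzkRankLeOne

/-- The stubs are literally the route's child decls (definitional unfolding, no sorry of its own):
S1 is `LeadingTerm.SelmerCapAtOnePrime` (stmt-19215), S2 is `LeadingTerm.GZKRankLeOne` (stmt-17525) —
so the lead's correct move is `blocked-on` those items, not a stub wave here. -/
theorem stubs_are_the_children :
    (Statement.stub_selmerCapAtOnePrime ↔ SelmerCapAtOnePrime) ∧
    (Statement.stub_gzkRankLeOne ↔ GZKRankLeOne) :=
  ⟨Iff.rfl, Iff.rfl⟩

/-- Disproof honoured: the landed negative lemma `Theorems.squeezeUB_false_without_isElliptic`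
(`Theorems/SqueezeUB/Negative/FalseWithoutIsElliptic.lean`, p131586; module not yet built on the farm at
registration time, hence cited rather than imported) — the crux with the `[W.IsElliptic]` binder deleted
is FALSE (cusp `y² = x³`: rank 1, analytic rank 0). Both stubs above keep the binder, and the witness is
not elliptic (checked here from Mathlib alone), so it instantiates neither stub. -/
example : ¬ (⟨0, 0, 0, 0, 0⟩ : WeierstrassCurve ℚ).IsElliptic := fun h => by
  have hΔ := h.isUnit
  simp [WeierstrassCurve.Δ, WeierstrassCurve.b₂, WeierstrassCurve.b₄, WeierstrassCurve.b₆,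
    WeierstrassCurve.b₈] at hΔ

end Summit.BirchSwinnertonDyer.BirchSwinnertonDyer.Cruxes.SqueezeUB.SelmerCapJunction
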